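import Summits.NavierStokesRegularity.NavierStokesRegularity.Theorems.PerpetualPumpAveragedTypeIBlowup
import Summits.NavierStokesRegularity.NavierStokesRegularity.Theorems.AveragedTypeIBlowup.Negative.NSReduction

/-!
# Refutation of `PerpetualPump.Thesis` (stmt-NavierStokesRegularity-1832): abstract Type-I exclusion over
# Tao's averaging class is FALSE

The route's target `Thesis` asserted ABSTRACT TYPE-I EXCLUSION: for every symmetric averaging datum `𝒜`
with cancellation (Tao, J. Amer. Math. Soc. 29 (2016), (1.12)–(1.16)), every Schwartz divergence-free
datum and every `H¹⁰_df`-mild solution on `[0,T)` obeying the Type-I rate `‖u(t)‖_∞ ≤ M(T-t)^{-1/2}`, the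
solution extends as a mild solution past `T` — the question Tao leaves open in his p. 8 footnote, at the
`L^∞`-rate tier. It is the classical negation of the route's crux #3 `AveragedTypeIBlowup` (the PDE
perpetual pump: an autonomous symmetric cancelling averaged Navier–Stokes equation with a Type-I blow-up
from Schwartz data), which is now a THEOREM of the tree
(`Theorems.PerpetualPumpAveragedTypeIBlowup.AveragedTypeIBlowup_of`: the m = 2 seeded graded Toda local
cascade, its DSS Type-I threshold chain, synthesis of an `H¹⁰_df`-mild solution, non-extension, and Tao's
Theorem 3.2 transfer). Hence `not_Thesis` below.

CLASSIFICATION — `refuted-substantive`. The witness is a genuine member of Tao's class (no missing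
normalisation or degenerate case is exploited): symmetric, cancelling, autonomous, Schwartz divergence-free
datum, honest `H¹⁰_df`-mild solution, honest `L^∞` Type-I rate. No cheap repair exists: by the results of
line `SketchIdeator2` (this session) the `H¹⁰` local theory, the abstract Leray floor in the Besov envelope
(`stub_thesis_AbstractLerayFloor`) and the envelope upgrade (`stub_envelopeUpgrade`) all HOLD abstractly,
and `Thesis ↔ NoPersistentFront` (`stub_thesis_iff_noPersistentFront`); so what fails is exactly the
rigidity core — there IS a persistent front (`exists_persistentFront`, appended once the envelope files are built): an `H¹⁰_df`-mild solution of a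
symmetric cancelling averaged equation whose envelope amplitude `√(T-t)‖u(t)‖_{Ḃ⁰_{∞,1}}` stays pinched
between two positive constants up to the blow-up time. BARRIER-CANDIDATE: abstract Liouville / Type-I
exclusion (KNSS, Tsai's DSS-Liouville, Seregin–Šverák) cannot be proved by any argument that treats the
bilinear operator abstractly (energy identity + order-0 harmonic analysis + scaling + autonomy + the full
`Ḃ⁰_{∞,1}` perturbation theory): every positive Liouville route must name its fine-structure input.
-/

noncomputable section

set_option linter.dupNamespace false

namespace Summit.NavierStokesRegularity.NavierStokesRegularity.Theorems

open MeasureTheory Set Filter Topology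
open scoped ENNReal NNReal SchwartzMap
open Literature.Analysis.FluidPDE Literature.Analysis.FluidPDE.Tao2016
open Summit.NavierStokesRegularity.NavierStokesRegularity.Theses.PerpetualPump
open Summit.NavierStokesRegularity.NavierStokesRegularity.Theorems.AveragedTypeIBlowup.Negative

/-- **`Thesis` is false (refuted-substantive).** Abstract Type-I exclusion over Tao's averaging class
fails: the averaged Type-I perpetual pump `AveragedTypeIBlowup_of` (crux #3 of the route, a theorem) is a
symmetric cancelling averaging datum with a Schwartz divergence-free datum and an `H¹⁰_df`-mild solution on
`[0,T)` at the Type-I rate admitting NO mild extension past `T`; `Thesis ↔ ¬AveragedTypeIBlowup`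
(`averagedTypeIBlowup_iff_not_thesis`). Witness: the m = 2 seeded graded Toda local cascade at fine dyadic
parameter (Tao 2016 Def. 3.1 / Thm. 3.2). No cheap repair: the local theory, the abstract Leray floor and
the envelope upgrade hold abstractly (line `SketchIdeator2`), so the failure is the rigidity core itself
(`exists_persistentFront`). -/
theorem not_Thesis : ¬ Summit.NavierStokesRegularity.NavierStokesRegularity.Theses.PerpetualPump.Thesis :=
  averagedTypeIBlowup_iff_not_thesis.mp PerpetualPumpAveragedTypeIBlowup.AveragedTypeIBlowup_of

end Summit.NavierStokesRegularity.NavierStokesRegularity.Theorems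

end
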